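import Mathlib.Data.Finset.Sort
import Literature.ModelTheory.Quasiminimal.Cofaces
import HarnessLib

/-!
# Large models of a quasiminimal class: the directed system over finite subsets of a linear order

Let `M` be a countable weakly quasiminimal pregeometry structure, `P ⊆ M`, `p, q : ℕ → M`
jointly independent over `P`, `O_l = cl (P ∪ {q_i : i < l})` the simplices and
`D l j : O_l → O_{l+1}` the coherent cofaces of `Cofaces.lean`. For a linearly ordered index
type `S` we build the **directed system of relabellings** indexed by finite subsets `X ⊆ Y` of `S`: the object at `X` is the closed set
`O_{|X|}` (its vertices `q_0, …, q_{|X|-1}` standing for the elements of `X` in increasing order),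
and `Φ X Y : O_{|X|} → O_{|Y|}` inserts the elements of `Y ∖ X` one at a time, each by the coface at
its position; the cosimplicial identities make the result independent of the order of insertion
(`insMap_perm`), whence functoriality `Φ Y Z ∘ Φ X Y = Φ X Z`.

This is the combinatorial content of the existence of arbitrarily large models of a quasiminimal
class (Kirby 2010, Thm 4.2: "a chain `(M_μ)` where each `M_μ` has a chosen basis indexed by `μ`,
and the inclusion maps extend the inclusion maps of the ordinals"; Bays–Hart–Hyttinen–Kesälä–
Kirby 2014, Thm 2.3, existence half), organised over finite subsets instead of ordinals so that
every object is a countable closed subset of the one countable model `M`: the direct limit of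
the system along `S` is covered by closed copies of the `O_l`, has an element `[q_0]_{{s}}` for
each `s ∈ S`, pairwise distinct, and so has cardinality `max(ℵ₀, #S)` (the limit itself is formed
in the application, e.g. as a direct limit of fields).

## Contents

* `posIn W s` — the position of `s` in `W ∪ {s}`; `insMap D ws W` — insert the list `ws` into `W`.
* `insMap_perm` — independence of the order of insertion (from the cosimplicial identities).
* `IsWeaklyQuasiminimalPregeometryStructure.exists_finsetSystem` — the directed system `Φ`.

## References

* J. Kirby, *On quasiminimal excellent classes*, J. Symbolic Logic 75 (2010), Thm 4.2.
* M. Bays, B. Hart, T. Hyttinen, M. Kesälä, J. Kirby, *Quasiminimal structures and excellence*,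
  Bull. LMS 46 (2014), Thm 2.3.
-/

noncomputable section

open Set FirstOrder FirstOrder.Language

universe u v w

namespace Literature.ModelTheory.Quasiminimal

variable {L : Language.{u, v}} {M : Type w} [L.Structure M] {cl : Set M → Set M}

/-! ### Coface systems, abstractly -/

section System

variable (L cl)

/-- The properties of the coherent coface system of `Cofaces.lean` that are used downstream
(`exists_cofaceSystem` provides such a `D`). [folklore] -/
structure IsCofaceSystem (P : Set M) (q : ℕ → M) (D : ℕ → ℕ → M → M) : Prop where
  /-- `D l j` is a partial embedding on `O_l` -/
  isQFEmbOn : ∀ l j, j ≤ l → IsQFEmbOn L (D l j) (cl (P ∪ (q '' {i | i < l})))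
  /-- `D l j` carries closed sub-simplices to closed sub-simplices -/
  image_cl : ∀ l j (I : Set ℕ), j ≤ l → I ⊆ {i | i < l} →
    D l j '' cl (P ∪ (q '' I)) = cl (P ∪ (q '' (cofaceIdx j '' I)))
  /-- `D l j` relabels the vertices by `δ^j` -/
  apply_vertex : ∀ l j i, j ≤ l → i < l → D l j (q i) = q (cofaceIdx j i)
  /-- the cosimplicial identities -/
  ident : ∀ l i j, i < j → j ≤ l + 1 → ∀ z ∈ cl (P ∪ (q '' {t | t < l})),
    D (l + 1) j (D l i z) = D (l + 1) i (D l (j - 1) z)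

variable {L cl}

/-- `Cofaces.lean` provides a coface system. [folklore] -/
theorem IsWeaklyQuasiminimalPregeometryStructure.exists_isCofaceSystem [Countable M]
    (hW : IsWeaklyQuasiminimalPregeometryStructure L M cl) {P : Set M} {p q : ℕ → M}
    (hpq : IndepFamilyOver cl P (Sum.elim p q)) : ∃ D, IsCofaceSystem L cl P q D := by
  obtain ⟨D, h1, h2, h3, h4⟩ := hW.exists_cofaceSystem hpq
  exact ⟨D, ⟨h1, h2, h3, h4⟩⟩

end System

/-! ### Insertion maps -/

section Insert

variable {S : Type*} [LinearOrder S]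

/-- The position of `s` in `W ∪ {s}`: the number of elements of `W` below `s`. [folklore] -/
def posIn (W : Finset S) (s : S) : ℕ := (W.filter (· < s)).card

/-- Positions are at most the size. [folklore] -/
theorem posIn_le (W : Finset S) (s : S) : posIn W s ≤ W.card := Finset.card_filter_le _ _

/-- Inserting an element above `s` does not change the position of `s`. [folklore] -/
theorem posIn_insert_of_lt {W : Finset S} {s t : S} (h : s < t) :
    posIn (insert t W) s = posIn W s := by
  unfold posIn
  rw [Finset.filter_insert, if_neg (not_lt.2 h.le)]

/-- Inserting an element below `t` (not yet present) shifts the position of `t` by one. [folklore] -/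
theorem posIn_insert_of_gt {W : Finset S} {s t : S} (h : s < t) (hs : s ∉ W) :
    posIn (insert s W) t = posIn W t + 1 := by
  unfold posIn
  rw [Finset.filter_insert, if_pos h, Finset.card_insert_of_notMem]
  exact fun hmem => hs (Finset.mem_filter.1 hmem).1

/-- Positions are monotone in the element. [folklore] -/
theorem posIn_mono (W : Finset S) {s t : S} (h : s ≤ t) : posIn W s ≤ posIn W t :=
  Finset.card_le_card fun x hx => by
    rw [Finset.mem_filter] at hx ⊢
    exact ⟨hx.1, lt_of_lt_of_le hx.2 h⟩

variable (D : ℕ → ℕ → M → M)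

/-- **Insertion maps**: `insMap D ws W` inserts the elements of the list `ws` into the finite set
`W`, in order, each by the coface `D |W'| (posIn W' s)` at its position. [folklore] -/
def insMap : List S → Finset S → M → M
  | [], _ => id
  | s :: ss, W => insMap ss (insert s W) ∘ D W.card (posIn W s)

/-- Inserting nothing. [folklore] -/
@[simp] theorem insMap_nil (W : Finset S) : insMap D [] W = id := rfl

/-- Inserting a head and a tail. [folklore] -/
theorem insMap_cons (s : S) (ss : List S) (W : Finset S) :
    insMap D (s :: ss) W = insMap D ss (insert s W) ∘ D W.card (posIn W s) := rfl

/-- Inserting a concatenation. [folklore] -/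
theorem insMap_append (ws ws' : List S) (W : Finset S) :
    insMap D (ws ++ ws') W = insMap D ws' (W ∪ ws.toFinset) ∘ insMap D ws W := by
  induction ws generalizing W with
  | nil => simp
  | cons s ss ih =>
    rw [List.cons_append, insMap_cons, insMap_cons, ih, Function.comp_assoc]
    congr 2
    ext x
    simp

variable {D}
variable {P : Set M} {q : ℕ → M}

/-- Insertion maps send `O_{|W|}` into `O_{|W| + |ws|}`. [folklore] -/
theorem insMap_mapsTo (h : IsPregeometry cl) (hD : IsCofaceSystem L cl P q D) :
    ∀ (ws : List S) (W : Finset S), ws.Nodup → (∀ s ∈ ws, s ∉ W) →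
      MapsTo (insMap D ws W) (cl (P ∪ (q '' {i | i < W.card})))
        (cl (P ∪ (q '' {i | i < W.card + ws.length}))) := by
  intro ws
  induction ws with
  | nil => intro W _ _ z hz; simpa using hz
  | cons s ss ih =>
    intro W hnd hdisj z hz
    rw [insMap_cons, Function.comp_apply]
    have hsW : s ∉ W := hdisj s (by simp)
    have hcard : (insert s W).card = W.card + 1 := Finset.card_insert_of_notMem hsW
    have hz' : D W.card (posIn W s) z ∈ cl (P ∪ (q '' {i | i < (insert s W).card})) := by
      rw [hcard]
      have him := hD.image_cl W.card (posIn W s) {i | i < W.card} (posIn_le W s) Subset.rfl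
      have : D W.card (posIn W s) z ∈ D W.card (posIn W s) '' cl (P ∪ (q '' {i | i < W.card})) :=
        mem_image_of_mem _ hz
      rw [him, image_cofaceIdx _ _ (posIn_le W s)] at this
      exact h.mono (union_subset_union_right P (image_mono fun t (ht : t < W.card + 1 ∧ t ≠ posIn W s) => ht.1)) this
    have := ih (insert s W) (List.nodup_cons.1 hnd).2
      (fun t ht htW => by
        rcases Finset.mem_insert.1 htW with rfl | htW
        · exact (List.nodup_cons.1 hnd).1 ht
        · exact hdisj t (List.mem_cons_of_mem s ht) htW) hz'
    rw [hcard] at this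
    simpa [Nat.add_assoc, Nat.add_comm 1] using this

/-- Insertion maps are partial embeddings on `O_{|W|}`. [folklore] -/
theorem insMap_isQFEmbOn (h : IsPregeometry cl) (hD : IsCofaceSystem L cl P q D) :
    ∀ (ws : List S) (W : Finset S), ws.Nodup → (∀ s ∈ ws, s ∉ W) →
      IsQFEmbOn L (insMap D ws W) (cl (P ∪ (q '' {i | i < W.card}))) := by
  intro ws
  induction ws with
  | nil => intro W _ _; exact IsQFEmbOn.id _
  | cons s ss ih =>
    intro W hnd hdisj
    rw [insMap_cons]
    have hsW : s ∉ W := hdisj s (by simp)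
    have hcard : (insert s W).card = W.card + 1 := Finset.card_insert_of_notMem hsW
    refine (hD.isQFEmbOn W.card (posIn W s) (posIn_le W s)).comp ?_
    have him := hD.image_cl W.card (posIn W s) {i | i < W.card} (posIn_le W s) Subset.rfl
    rw [him, image_cofaceIdx _ _ (posIn_le W s)]
    refine (ih (insert s W) (List.nodup_cons.1 hnd).2 fun t ht htW => ?_).mono ?_
    · rcases Finset.mem_insert.1 htW with rfl | htW
      · exact (List.nodup_cons.1 hnd).1 ht
      · exact hdisj t (List.mem_cons_of_mem s ht) htW
    · rw [hcard]
      exact h.mono (union_subset_union_right P (image_mono fun t (ht : t < W.card + 1 ∧ t ≠ posIn W s) => ht.1))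

/-- Images of closed sub-simplices under insertion maps are closed sub-simplices. [folklore] -/
theorem insMap_image_cl (hD : IsCofaceSystem L cl P q D) :
    ∀ (ws : List S) (W : Finset S), ws.Nodup → (∀ s ∈ ws, s ∉ W) →
      ∀ I : Set ℕ, I ⊆ {i | i < W.card} →
        ∃ I' : Set ℕ, I' ⊆ {i | i < W.card + ws.length} ∧
          insMap D ws W '' cl (P ∪ (q '' I)) = cl (P ∪ (q '' I')) := by
  intro ws
  induction ws with
  | nil => intro W _ _ I hI; exact ⟨I, by simpa using hI, by simp⟩
  | cons s ss ih =>
    intro W hnd hdisj I hI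
    have hsW : s ∉ W := hdisj s (by simp)
    have hcard : (insert s W).card = W.card + 1 := Finset.card_insert_of_notMem hsW
    rw [insMap_cons, image_comp, hD.image_cl W.card (posIn W s) I (posIn_le W s) hI]
    obtain ⟨I', hI', heq⟩ := ih (insert s W) (List.nodup_cons.1 hnd).2
      (fun t ht htW => by
        rcases Finset.mem_insert.1 htW with rfl | htW
        · exact (List.nodup_cons.1 hnd).1 ht
        · exact hdisj t (List.mem_cons_of_mem s ht) htW)
      (cofaceIdx (posIn W s) '' I) (by
        rw [hcard]
        rintro _ ⟨i, hi, rfl⟩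
        exact cofaceIdx_lt_succ (hI hi))
    refine ⟨I', ?_, heq⟩
    rw [hcard] at hI'
    simpa [Nat.add_assoc, Nat.add_comm 1] using hI'

/-- **Independence of the order of insertion** (from the cosimplicial identities): permuting the
list of inserted elements does not change the insertion map on `O_{|W|}`. [folklore] -/
theorem insMap_perm (h : IsPregeometry cl) (hD : IsCofaceSystem L cl P q D) {ws ws' : List S}
    (hp : ws.Perm ws') :
    ∀ W : Finset S, ws.Nodup → (∀ s ∈ ws, s ∉ W) →
      ∀ z ∈ cl (P ∪ (q '' {i | i < W.card})), insMap D ws W z = insMap D ws' W z := by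
  induction hp with
  | nil => intro W _ _ z _; rfl
  | cons s _ ih =>
    intro W hnd hdisj z hz
    rw [insMap_cons, insMap_cons, Function.comp_apply, Function.comp_apply]
    have hsW : s ∉ W := hdisj s (by simp)
    have hcard : (insert s W).card = W.card + 1 := Finset.card_insert_of_notMem hsW
    refine ih (insert s W) (List.nodup_cons.1 hnd).2 (fun t ht htW => ?_) _ ?_
    · rcases Finset.mem_insert.1 htW with rfl | htW
      · exact (List.nodup_cons.1 hnd).1 ht
      · exact hdisj t (List.mem_cons_of_mem s ht) htW
    · rw [hcard]
      have him := hD.image_cl W.card (posIn W s) {i | i < W.card} (posIn_le W s) Subset.rfl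
      have : D W.card (posIn W s) z ∈ D W.card (posIn W s) '' cl (P ∪ (q '' {i | i < W.card})) :=
        mem_image_of_mem _ hz
      rw [him, image_cofaceIdx _ _ (posIn_le W s)] at this
      exact h.mono (union_subset_union_right P (image_mono fun t (ht : t < W.card + 1 ∧ t ≠ posIn W s) => ht.1)) this
  | swap s t l =>
    intro W hnd hdisj z hz
    -- `t :: s :: l` versus `s :: t :: l`
    simp only [insMap_cons, Function.comp_apply]
    have hst : s ≠ t := fun h => by
      have := (List.nodup_cons.1 hnd).1; simp [h] at this
    have hsW : s ∉ W := hdisj s (by simp)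
    have htW : t ∉ W := hdisj t (by simp)
    have hcs : (insert s W).card = W.card + 1 := Finset.card_insert_of_notMem hsW
    have hct : (insert t W).card = W.card + 1 := Finset.card_insert_of_notMem htW
    rw [Finset.insert_comm s t W, hcs, hct]
    congr 1
    rcases lt_or_gt_of_ne hst with h | h
    · -- `s < t`
      rw [posIn_insert_of_lt h, posIn_insert_of_gt h hsW]
      exact (hD.ident W.card (posIn W s) (posIn W t + 1)
        (Nat.lt_succ_of_le (posIn_mono W h.le)) (Nat.succ_le_succ (posIn_le W t)) z hz).symm
    · -- `t < s`
      rw [posIn_insert_of_lt h, posIn_insert_of_gt h htW]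
      exact hD.ident W.card (posIn W t) (posIn W s + 1)
        (Nat.lt_succ_of_le (posIn_mono W h.le)) (Nat.succ_le_succ (posIn_le W s)) z hz
  | trans h₁ h₂ ih₁ ih₂ =>
    intro W hnd hdisj z hz
    rw [ih₁ W hnd hdisj z hz]
    exact ih₂ W (h₁.nodup_iff.1 hnd) (fun s hs => hdisj s (h₁.mem_iff.2 hs)) z hz

end Insert

/-! ### The directed system over finite subsets of a linear order -/

namespace IsWeaklyQuasiminimalPregeometryStructure

variable {S : Type*} [LinearOrder S]

omit [L.Structure M] in
/-- The list of elements to insert to pass from `X` to `Y ⊇ X`. [folklore] -/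
theorem toList_sdiff_spec {X Y : Finset S} (hXY : X ⊆ Y) :
    (Y \ X).toList.Nodup ∧ (∀ s ∈ (Y \ X).toList, s ∉ X) ∧
      X.card + (Y \ X).toList.length = Y.card ∧ X ∪ (Y \ X).toList.toFinset = Y := by
  refine ⟨Finset.nodup_toList _, fun s hs => (Finset.mem_sdiff.1 (Finset.mem_toList.1 hs)).2,
    ?_, ?_⟩
  · rw [Finset.length_toList, add_comm, Finset.card_sdiff_add_card_eq_card hXY]
  · rw [Finset.toList_toFinset, Finset.union_sdiff_of_subset hXY]

/-- **The directed system of simplices over finite subsets of a linear order** (existence of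
large models of a quasiminimal class, combinatorial form: Kirby 2010 Thm 4.2 / BHHKK 2014
Thm 2.3, existence half). Let `M` be a countable weakly quasiminimal pregeometry structure,
`p, q : ℕ → M` jointly independent over `P ⊆ M` and `S` a linear order. Then there are maps
`Φ X Y : M → M` (`X ⊆ Y` finite subsets of `S`) such that, with `O_l = cl (P ∪ {q_i : i < l})`:
`Φ X X = id` and
`Φ Y Z ∘ Φ X Y = Φ X Z` on `O_{|X|}` (functoriality); `Φ X Y` is a partial embedding of `O_{|X|}`
into `O_{|Y|}` whose image is a closed sub-simplex `cl (P ∪ q[I])`; and for `s < t` the vertex `q_0`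
of `O_1` is sent by `Φ {s} {s,t}` to `q_0` and by `Φ {t} {s,t}` to `q_1` (so the direct limit
along `S` has at least `#S` elements). [cite: Kirby2010QMEC, Thm 4.2] -/
theorem exists_finsetSystem [Countable M] (hW : IsWeaklyQuasiminimalPregeometryStructure L M cl)
    {P : Set M} {p q : ℕ → M} (hpq : IndepFamilyOver cl P (Sum.elim p q)) (S : Type*) [LinearOrder S] :
    ∃ Φ : Finset S → Finset S → M → M,
      (∀ X : Finset S, ∀ z ∈ cl (P ∪ (q '' {i | i < X.card})), Φ X X z = z) ∧
      (∀ X Y Z : Finset S, X ⊆ Y → Y ⊆ Z → ∀ z ∈ cl (P ∪ (q '' {i | i < X.card})),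
        Φ Y Z (Φ X Y z) = Φ X Z z) ∧
      (∀ X Y : Finset S, X ⊆ Y → IsQFEmbOn L (Φ X Y) (cl (P ∪ (q '' {i | i < X.card})))) ∧
      (∀ X Y : Finset S, X ⊆ Y →
        MapsTo (Φ X Y) (cl (P ∪ (q '' {i | i < X.card}))) (cl (P ∪ (q '' {i | i < Y.card})))) ∧
      (∀ X Y : Finset S, X ⊆ Y → ∃ I : Set ℕ, I ⊆ {i | i < Y.card} ∧
        Φ X Y '' cl (P ∪ (q '' {i | i < X.card})) = cl (P ∪ (q '' I))) ∧
      ∀ s t : S, s < t → Φ {s} {s, t} (q 0) = q 0 ∧ Φ {t} {s, t} (q 0) = q 1 := by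
  classical
  have hP := hW.isPregeometry
  obtain ⟨D, hD⟩ := hW.exists_isCofaceSystem hpq
  refine ⟨fun X Y => insMap D (Y \ X).toList X, fun X z _ => ?_, fun X Y Z hXY hYZ z hz => ?_,
    fun X Y hXY => ?_, fun X Y hXY => ?_, fun X Y hXY => ?_, fun s t hst => ?_⟩
  · simp
  · obtain ⟨hnd₁, hdj₁, -, hun₁⟩ := toList_sdiff_spec hXY
    obtain ⟨hnd₂, hdj₂, -, -⟩ := toList_sdiff_spec hYZ
    change insMap D (Z \ Y).toList Y (insMap D (Y \ X).toList X z) = insMap D (Z \ X).toList X z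
    have happ := congr_fun (insMap_append D (Y \ X).toList (Z \ Y).toList X) z
    rw [hun₁, Function.comp_apply] at happ
    rw [← happ]
    -- the two lists enumerate `Z \ X`
    have hnd : ((Y \ X).toList ++ (Z \ Y).toList).Nodup := by
      refine List.Nodup.append hnd₁ hnd₂ fun s hs₁ hs₂ => ?_
      have h1 := Finset.mem_sdiff.1 (Finset.mem_toList.1 hs₁)
      have h2 := Finset.mem_sdiff.1 (Finset.mem_toList.1 hs₂)
      exact h2.2 h1.1
    have hperm : ((Y \ X).toList ++ (Z \ Y).toList).Perm (Z \ X).toList := by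
      refine List.perm_of_nodup_nodup_toFinset_eq hnd (Finset.nodup_toList _) ?_
      rw [List.toFinset_append, Finset.toList_toFinset, Finset.toList_toFinset,
        Finset.toList_toFinset]
      ext s
      simp only [Finset.mem_union, Finset.mem_sdiff]
      constructor
      · rintro (⟨h1, h2⟩ | ⟨h1, h2⟩)
        · exact ⟨hYZ h1, h2⟩
        · exact ⟨h1, fun h => h2 (hXY h)⟩
      · rintro ⟨h1, h2⟩
        by_cases hsY : s ∈ Y
        · exact Or.inl ⟨hsY, h2⟩
        · exact Or.inr ⟨h1, hsY⟩
    exact insMap_perm hP hD hperm X hnd (fun s hs => by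
      rcases List.mem_append.1 hs with hs | hs
      · exact hdj₁ s hs
      · exact fun hsX => (Finset.mem_sdiff.1 (Finset.mem_toList.1 hs)).2 (hXY hsX)) z hz
  · obtain ⟨hnd, hdj, -, -⟩ := toList_sdiff_spec hXY
    exact insMap_isQFEmbOn hP hD _ X hnd hdj
  · obtain ⟨hnd, hdj, hlen, -⟩ := toList_sdiff_spec hXY
    have := insMap_mapsTo hP hD _ X hnd hdj
    rwa [hlen] at this
  · obtain ⟨hnd, hdj, hlen, -⟩ := toList_sdiff_spec hXY
    obtain ⟨I, hI, heq⟩ := insMap_image_cl hD _ X hnd hdj {i | i < X.card} Subset.rfl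
    rw [hlen] at hI
    exact ⟨I, hI, heq⟩
  · have hst' : s ≠ t := ne_of_lt hst
    have h1 : (({s, t} : Finset S) \ {s}) = {t} := by
      ext u
      simp only [Finset.mem_sdiff, Finset.mem_insert, Finset.mem_singleton]
      constructor
      · rintro ⟨h | h, h'⟩
        · exact absurd h h'
        · exact h
      · rintro rfl; exact ⟨Or.inr rfl, fun h => hst' h.symm⟩
    have h2 : (({s, t} : Finset S) \ {t}) = {s} := by
      ext u
      simp only [Finset.mem_sdiff, Finset.mem_insert, Finset.mem_singleton]
      constructor
      · rintro ⟨h | h, h'⟩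
        · exact h
        · exact absurd h h'
      · rintro rfl; exact ⟨Or.inl rfl, hst'⟩
    have hps : posIn ({s} : Finset S) t = 1 := by
      unfold posIn
      rw [Finset.filter_singleton, if_pos hst, Finset.card_singleton]
    have hpt : posIn ({t} : Finset S) s = 0 := by
      unfold posIn
      rw [Finset.filter_singleton, if_neg (not_lt.2 hst.le), Finset.card_empty]
    constructor
    · change insMap D (({s, t} : Finset S) \ {s}).toList {s} (q 0) = q 0
      rw [h1, Finset.toList_singleton, insMap_cons, insMap_nil, Function.comp_apply, id,
        Finset.card_singleton, hps, hD.apply_vertex 1 1 0 le_rfl Nat.one_pos,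
        cofaceIdx_of_lt Nat.one_pos]
    · change insMap D (({s, t} : Finset S) \ {t}).toList {t} (q 0) = q 1
      rw [h2, Finset.toList_singleton, insMap_cons, insMap_nil, Function.comp_apply, id,
        Finset.card_singleton, hpt, hD.apply_vertex 1 0 0 (Nat.zero_le 1) Nat.one_pos,
        cofaceIdx_zero]

end IsWeaklyQuasiminimalPregeometryStructure

end Literature.ModelTheory.Quasiminimal

end
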